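import Summits.QuantumFields.BalabanUV.T4Continuum.Spine.NE1p.DressedRebornMuPart
import Summits.QuantumFields.BalabanUV.T4Continuum.Spine.NE1p.DressedSmallFieldDepCoresWitnessLive

/-!
# T⁴ programme, spine estimate NE1′ (node O3b/H2) — WITNESS «THE RE-BORN μ-PART FIRES ON A SEPARABLE TWO-DOMAIN DATUM»: S56 §3's BiCore
# bi-pencil END `DressedRebornMuPart.rebornMuPart_locE_le_of_coresAt_bipencil_mass_window` (leaf-03 g14) APPLIED ONCE BY NAME on a two-term
# family in W41's FORMAT (term-dependent carrier domains, W33's Gaussian cores, W24's one-cube torus datum) with TWO SINGLE-DOMAIN TABLES —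
# the source table on carrier domain 0, the content table on domain 1, one core per term reading ITS OWN domain; PART 1 of 2: the tables,
# the cores, the family, the letter budget, THE END

Cell `pub-balaban`, sub-cell `t4`, row NE1′ formalisation crew (`t4/formal/NE1p/LEAVES.md` row **W87 ∕ DAG N29zzzzu** — own-initiative WITNESS row
under typer R-T61 (ii); INTENT `HOME/CLAIMS.log` l.23711, provisional id by RULING R-T142 l.23746, firm at STAGED; read X225), unit
`b2b-balaban-t4-ne1p-formalise-leaf-09` (gen 14).  ADDITIVE — imports S56 `Spine/NE1p/DressedRebornMuPart` (leaf-03 g14, p239964; → S33 →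
N0r∕N0q∕N0p∕N0j → the owner's `DressedSmallFieldAllowance`) and this lineage's W41 PART 2 `Spine/NE1p/DressedSmallFieldDepCoresWitnessLive`
(p229827; → W41 PART 1, W35, W33 `DressedSmallFieldCoresWitness`, W24 `DressedSmallFieldTorusWitness`, row NE5's toy frame) ONLY; toy DATA
`def`s (the single-domain potentials and tables `tabV`∕`tab`, W33's core reading a GIVEN carrier domain `coreAt`, the placement `domB`, the
family `GB`, the content `vB`, the activity `actB` — the NAME `actB` is also W84's bi-pencil activity in ANOTHER namespace, harmless) + theorems; 0 `def … : Prop`, 0 cite, 0 sorry, 0 `attribute`; nothing of S56 ∕ S33 ∕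
N0p–N0r ∕ W24 ∕ W33 ∕ W35 ∕ W41 ∕ row NE5 ∕ row O1-c is restated — `rebornMuPart_locE_le_of_coresAt_bipencil_mass_window`, `ofMeasPotentials`∕
`VppM_ofMeasPotentials`∕`norm_ofMeasPotentials_le`, `liveV`∕`liveQ`∕`liveV_bound`∕`liveQ_bound`∕`liveV_measurable`∕`liveQ_measurable`, `crd`∕
`measurable_crd`∕`E1`∕`ctr0`∕`hroom0`∕`Acst`∕`Acst_pos`, `cM`∕`cM_pos`∕`letterGauss_E1`∕`hsmall_mu`, `termsD`∕`termsD_X₀`∕`budget_half`∕`dj_X₀`,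
`X₀`∕`eq_X₀_iff`∕`hrate_torus`, `torus_consts`, `K₀_four` are used BY NAME.

WHY.  S56 (leaf-03 g14) typed the RE-BORN μ-PART — the MIXED difference `E(μ,1) − E(0,1) − E(μ,0) + E(0,0)` of the dressed output as a
function of BOTH the observable's source `μ` and a family's content `s` — at three levels; its §3 (cores with term-dependent polymer
families along the BI-PENCIL `h₀ + μ • u + s • v`) had NO decided applier at INTENT (tree grep l.23711: the two §3 names in
`DressedRebornMuPart.lean` only; W84 = leaf-06 g13 fired §2 on W31's exp-linear datum); since then leaf-03 g14's W86
`DressedRebornMuPartBipencilWitness` (p242645) fires §3's `_mass` END on W35's ONE core along ONE table (`u = liveTable`, `v = ¼ • liveTable`,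
liveness at the source `¼` by Cauchy–Schwarz) — the §3 WINDOW END `…_mass_window` stays unfired.  The typer named the datum: «W41's dependent
family = leaf-09's natural datum» (R-T141).  THIS FILE fires the WINDOW END there with a twist that ISOLATES the logarithm: the two terms
read two DIFFERENT tables —
* §1 THE SINGLE-DOMAIN TABLES (toy DATA): `tab Y₀` carries W33's remainder potential `e^{−φ²}` on the carrier domain `Y₀` and `0` on every
  other domain (row O1-c's `ofMeasPotentials`; `VppM_tab_self`∕`VppM_tab_of_ne`; `‖tab Y₀‖ ≤ 1`); W33's `liveTable` carries `e^{−φ²}` at EVERY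
  domain, so no table of the tree separates domains;
* §2 THE CORE READING A GIVEN DOMAIN (toy DATA): `coreAt Y₀ c r` = W33's `coreW` with its one polymer label placed at `Y₀`
  (`readOut_coreAt : readOut p v h = r·V″(h)(Y₀, v 0)`); along the bi-pencil `0 + μ • tab 0 + s • v_B` with the CONTENT `v_B := ½ • tab 1`
  the core at `0` reads `μ·r·e^{−(v 0)²}` and the core at `1` reads `(s∕2)·r·e^{−(v 0)²}` — **each term sees ONE of the two parameters**;
* §3 THE FAMILY (toy DATA, W41's format): terms `Bool`, polymer family `Unit` per term placed by `domB` (term `false` ↦ domain `0`, `true` ↦ `1`),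
  `GB k b := coreAt (domB-point) (cM r∕2) r` (W35's weight), index W41's `termsD` (both terms on `X₀`, none elsewhere), activity `actB`;
  `tab_one_ne_zero` (`0 < r`: the core at `1` reads `r` off `tab 1` at `v = 0`), `norm_vB_le : ‖v_B‖ ≤ ½`;
* §4 THE LETTER BUDGET `hM3_B` at the table radius `‖0‖ + 1·‖tab 0‖ + 1 ≤ 2`: W41's `budget_half` ONCE PER TERM (`A∕2 + A∕2 = A`, `d(X₀) = 0`);
* §5 **`rebornEnd_fires`** — S56 §3's window END EXACTLY ONCE BY NAME at `(D, G) := (tsys 4 N, tgeometry 4 N)`, `𝔊 := GB`, W33's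
  `ctr0`∕`hroom0`, NE5's toy letters `(mq, bq, N₀) = (1, 0, 1)` INLINE, `(h₀, u, v, μ₁, ε) := (0, tab 0, v_B, 1, 1)` (`hH` at W33's history
  radius `2`; `0 < ‖v_B‖ < 1`), `hscale`∕`hact` by `rfl`, `(A, R, r₁, b₅) := (A_cst, 2κ₀ + 2, 0, 0)` with W24's `hrate_torus` and W35's
  `hsmall_mu`, `hM3_B`; for every `μ₀ < 1`, `‖μ‖ ≤ μ₀`, `0 < r`; conclusion LITERAL; **`rebornEnd_fires_closed`: `≤ 4·K₀(64,8)·μ₀·‖v_B‖`** and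
  **`rebornEnd_fires_unit_content`: `≤ 2·K₀(64,8)·μ₀`**.
PART 2 (`…SeparableWitnessLive`, THEOREMS ONLY): the two terms in CLOSED FORM along the bi-pencil, **`actB_mixedDiff_eq_zero`** (the activity
is ADDITIVELY SEPARABLE — its mixed difference VANISHES at every polymer and every pair of corners), the four one-cube exponentials
`exp E = 1 + w` (W24), the cross defect `= −(a(t) − a(0))·(b(1) − b(0)) = −(cM r∕2)²·∫incr(t·r)·∫incr(r∕2)` and **`rebornMuPart_live`**: the
END's bounded quantity is NOT zero at every real source `0 < t < 1` — the re-born μ-part is carried ENTIRELY by the non-linearity of the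
cluster logarithm (W84's exp-linear datum is the mirror image: there the activity's own mixed difference is live and the product term
cancels).

HONEST FRAMING.  A DECIDED TOY ([folklore]∕[arith]; 0 sorry; 0 citations — bracketed names are labels; no `def … : Prop` — the `def`s are
toy DATA): W33's one-dimensional Gaussian cores on row NE5's toy frame, NOT Bałaban's (2.14) densities; the single-domain tables, the
placement, the content `½ • tab 1` and every numeral are OURS; (B1a) is discharged at the cores inside S56∕S33 (a relocation onto row NE5's
exp-linear FORMAT hypothesis, whose identification with (2.14) is the substrate's DISPLAYED reading), (B1b) holds by construction on the toy,
(B3) = `hM3` is MET BY CHOICE of the Cauchy weights — UNPRINTED for Bałaban's cores (GAPS G-ne9p2-5), the clauses are (B5)-KIND arithmetic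
at pv22's located letters (`κ₀ = 64 log 162`, `K₀(64,8)`, `ν = 9`, `c₁ = 64`); the μ-extension and the «re-born μ-part ∕ dressed regeneration
constant» READING are the cell's, UNPRINTED ([Balaban1989LargeFieldII] p. 356 defers observables; C-t4r2-340 (n1); `DressedSmallFieldAllowance`
§2–§4); this file says NOTHING about which part of a regenerated family's content Bałaban's densities attach to an observable; no numeral
of [Balaban1988RGII] ((2.14) p. 15, (2.38) p. 20, (2.41) p. 21 = TYPE∕CONTEXT via the imported headers); 0 binders instantiated on
Bałaban's densities; no wall item; wall v1.8 (T4-DAG v48 deb37c21e2d251d1; v49∕v50 verbatim) — words, not kind — does NOT move; R-t4r2-Q2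
NOT met thereby; NE1′ ⇐ the named binders — NOT proved, NOT printed; spine PROVED 0∕9; count 9 unchanged.  ABSOLUTE RULE honoured.
Rung (B)+1 on ONE finite four-torus — NOT infinite volume, NOT a mass gap, NOT OS on ℝ⁴, NOT Clay.
HONEST DEPENDENCY: continuum YM on T⁴ ⇐ BetaPertH ∧ nine spine estimates (0/9 proved); BetaPertH ⇐ (D1) ∧ (D4) ∧ CAP+tail; G-an2-4
gates asym, D1 and NE2/3/4.
-/

noncomputable section

namespace Summit.QuantumFields.BalabanUV.T4Continuum.NE1p.DressedRebornMuPartSeparableWitness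

open Set Metric MeasureTheory Complex
open scoped BigOperators
open Literature.MathematicalPhysics.QuantumFieldTheory.Balaban1983to89
open Literature.MathematicalPhysics.QuantumFieldTheory.Balaban1983to89.B12TreeDecay (K₀ K₀_pos)
open Literature.MathematicalPhysics.QuantumFieldTheory.Balaban1983to89.B13Resummation (locE)
open Literature.MathematicalPhysics.QuantumFieldTheory.Balaban1983to89.TreeLengthTorus (TDom tsys)
open Literature.MathematicalPhysics.QuantumFieldTheory.Balaban1983to89.TreeLengthTorusGeometry (tgeometry TTouch)
open Summit.QuantumFields.BalabanUV.T4Continuum.B13HistDatum (level136)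
open Summit.QuantumFields.BalabanUV.T4Continuum.B13HistMeasurable (B13HistM)
open Summit.QuantumFields.BalabanUV.T4Continuum.B13HistWitness (toyFrame level136_toyFrame)
open Summit.QuantumFields.BalabanUV.T4Continuum.B13TermParamGaussianBi (BiCore)
open Summit.QuantumFields.BalabanUV.T4Continuum.InsertionLinearClass (linToyCarriers)
open Summit.QuantumFields.BalabanUV.T4Continuum.NE1p.DressedSmallFieldTorusWitness (X₀ X₀_val eq_X₀_iff hrate_torus)
open Summit.QuantumFields.BalabanUV.T4Continuum.NE1p.DressedSmallFieldGeometry (torus_consts)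
open Summit.QuantumFields.BalabanUV.T4Continuum.NE1p.DressedSmallFieldGeometryFaces (K₀_four)
open Summit.QuantumFields.BalabanUV.T4Continuum.NE1p.DressedSmallFieldCoresWitness (E1 crd measurable_crd liveV liveQ liveV_bound
  liveQ_bound liveV_measurable liveQ_measurable ctr0 hroom0 Acst Acst_pos)
open Summit.QuantumFields.BalabanUV.T4Continuum.NE1p.DressedSmallFieldCoresMassWitness (cM cM_pos letterGauss_E1 hsmall_mu)
open Summit.QuantumFields.BalabanUV.T4Continuum.NE1p.DressedSmallFieldDepCoresWitness (termsD termsD_X₀ budget_half dj_X₀)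
open Summit.QuantumFields.BalabanUV.T4Continuum.NE1p.DressedRebornMuPart (rebornMuPart_locE_le_of_coresAt_bipencil_mass_window)

/-! ## §1 THE SINGLE-DOMAIN TABLES: W33's remainder potential `e^{−φ²}` on ONE carrier domain, `0` on every other -/

open Classical in
/-- The single-domain remainder potentials (toy DATA): `V″(Y, φ) = e^{−φ²}` if `Y = Y₀` (W33's `liveV` BY NAME), `0` otherwise. [folklore] -/
def tabV (Y₀ : ℕ) : (Y : ℕ) → toyFrame.Arg Y → ℂ := fun Y φ => if Y = Y₀ then liveV Y φ else 0

/-- The (1.36) bound with the factor `1` (W33's `liveV_bound` on the chosen domain, `0 ≤ 1` elsewhere). [folklore] -/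
theorem tabV_bound (Y₀ Y : ℕ) (φ : toyFrame.Arg Y) : ‖tabV Y₀ Y φ‖ ≤ 1 * level136 toyFrame.consts (linToyCarriers.d Y) := by
  unfold tabV
  split_ifs
  · exact liveV_bound Y φ
  · rw [norm_zero, level136_toyFrame]; norm_num

/-- Measurability in the field argument (the branch does not depend on `φ`). [folklore] -/
theorem tabV_measurable (Y₀ Y : ℕ) : Measurable (tabV Y₀ Y) := by
  unfold tabV
  by_cases h : Y = Y₀
  · simp only [if_pos h]; exact liveV_measurable Y
  · simp only [if_neg h]; exact measurable_const

/-- **THE SINGLE-DOMAIN TABLE** (toy DATA): row O1-c's `ofMeasPotentials` on `tabV Y₀` and W33's `liveQ ≡ 0`, factor `1`. [folklore] -/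
def tab (Y₀ : ℕ) : B13HistM toyFrame :=
  toyFrame.ofMeasPotentials (tabV Y₀) liveQ 1 (tabV_bound Y₀) liveQ_bound (tabV_measurable Y₀) liveQ_measurable

/-- The constructor reproduces the potential (BY THEOREM `VppM_ofMeasPotentials`). [folklore] -/
theorem VppM_tab (Y₀ Y : ℕ) (φ : ℝ) : toyFrame.VppM (tab Y₀) Y φ = tabV Y₀ Y φ :=
  toyFrame.VppM_ofMeasPotentials (tabV Y₀) liveQ 1 (tabV_bound Y₀) liveQ_bound (tabV_measurable Y₀) liveQ_measurable Y φ

/-- **ON ITS OWN DOMAIN the table is W33's `e^{−φ²}`.** [folklore] -/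
theorem VppM_tab_self (Y₀ : ℕ) (φ : ℝ) : toyFrame.VppM (tab Y₀) Y₀ φ = (Real.exp (-(φ ^ 2)) : ℂ) := by
  rw [VppM_tab]; unfold tabV liveV; rw [if_pos rfl]

/-- **ON EVERY OTHER DOMAIN the table VANISHES.** [folklore] -/
theorem VppM_tab_of_ne {Y₀ Y : ℕ} (h : Y ≠ Y₀) (φ : ℝ) : toyFrame.VppM (tab Y₀) Y φ = 0 := by
  rw [VppM_tab]; unfold tabV; rw [if_neg h]

/-- The single-domain table lies in the unit ball. [folklore] -/
theorem norm_tab_le (Y₀ : ℕ) : ‖tab Y₀‖ ≤ 1 := toyFrame.norm_ofMeasPotentials_le _ _ zero_le_one _ _ _ _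

/-! ## §2 THE CORE READING A GIVEN CARRIER DOMAIN (W33's `coreW` with its one polymer label placed at `Y₀`) -/

/-- **THE CORE AT THE DOMAIN `Y₀`** (toy DATA) [decided toy]: W33's `coreW` field for field — parameters `Unit` with the Dirac mass, Cauchy
weight the constant `c`, NE5's toy letters `N := 1`, `q := ‖v‖²`, no constraints, ONE polymer label placed at the carrier domain `Y₀`, contour
weight `τ := r` on the circle `rad := r`, field map `B () v := v 0`.  Not Bałaban's (2.14) data. [folklore] -/
def coreAt (Y₀ : ℕ) (c r : ℝ) (hr : 0 ≤ r) : BiCore toyFrame (fun _ : Unit => Y₀) ℂ Unit E1 where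
  lam := Measure.dirac ()
  finite := by infer_instance
  w := fun _ => (c : ℂ)
  measW := measurable_const
  wB := |c|
  norm_w_le := fun _ => by rw [Complex.norm_real, Real.norm_eq_abs]
  N := fun _ _ => 1
  q := fun _ _ v => ((‖v‖ ^ 2 : ℝ) : ℂ)
  cons := []
  nsign := 0
  D := {()}
  τ := fun _ _ => (r : ℂ)
  measτ := fun _ => measurable_const
  rad := fun _ => r
  rad_nonneg := fun _ => hr
  norm_τ_le := fun _ _ => by rw [Complex.norm_real, Real.norm_eq_abs, abs_of_nonneg hr]
  B := fun _ v => crd v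
  measB := fun _ => measurable_crd

section Core
variable (Y₀ : ℕ) (c r : ℝ) (hr : 0 ≤ r)

/-- No constraints: the potential-free factor is `1`. [folklore] -/
theorem chi_coreAt (v : E1) : (coreAt Y₀ c r hr).chi v = 1 := by unfold BiCore.chi BiCore.chiSet; simp [coreAt]

/-- **THE READ-OUT READS THE TABLE AT THE DOMAIN `Y₀`**: `readOut p v h = r·V″(h)(Y₀, v 0)` (`readOut_apply` BY NAME). [folklore] -/
theorem readOut_coreAt (p : Unit) (v : E1) (h : B13HistM toyFrame) :
    (coreAt Y₀ c r hr).readOut p v h = (r : ℂ) * toyFrame.VppM h Y₀ (crd v) := by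
  rw [BiCore.readOut_apply]; show ∑ Y ∈ ({()} : Finset Unit), (r : ℂ) * _ = _; rw [Finset.sum_singleton]; rfl

/-- The core at `Y₀` READS the table `tab Y₀`: `r·e^{−(v 0)²}`. [folklore] -/
theorem readOut_coreAt_tab_self (p : Unit) (v : E1) :
    (coreAt Y₀ c r hr).readOut p v (tab Y₀) = (r : ℂ) * (Real.exp (-(crd v ^ 2)) : ℂ) := by
  rw [readOut_coreAt, VppM_tab_self]

/-- The core at `Y₀` is BLIND to the table `tab Y₁`, `Y₁ ≠ Y₀`. [folklore] -/
theorem readOut_coreAt_tab_of_ne (p : Unit) (v : E1) {Y₁ : ℕ} (h : Y₀ ≠ Y₁) :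
    (coreAt Y₀ c r hr).readOut p v (tab Y₁) = 0 := by
  rw [readOut_coreAt, VppM_tab_of_ne h, mul_zero]

/-- The core's letter `N₁ = r·level136 = r`. [folklore] -/
theorem N₁_coreAt : (coreAt Y₀ c r hr).N₁ = r := by
  unfold BiCore.N₁; show ∑ Y ∈ ({()} : Finset Unit), r * level136 toyFrame.consts (linToyCarriers.d Y₀) = r
  rw [Finset.sum_singleton, level136_toyFrame, mul_one]

/-- The LETTER mass of the core at NE5's toy letters `(mq, bq, N₀) = (1, 0, 1)`: `|c|·√(2π)` (W35's `letterGauss_E1` BY NAME). [folklore] -/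
theorem letterMass_coreAt :
    (coreAt Y₀ c r hr).lam.real univ * ((coreAt Y₀ c r hr).wB * (1 : ℝ) * Real.exp (0 : ℝ)) *
        (Real.pi / ((1 : ℝ) / 2)) ^ (Module.finrank ℝ E1 / 2 : ℝ) = |c| * Real.sqrt (2 * Real.pi) := by
  rw [letterGauss_E1, Real.exp_zero, mul_one, mul_one]
  show (Measure.dirac ()).real univ * |c| * Real.sqrt (2 * Real.pi) = _
  rw [probReal_univ, one_mul]

end Core

/-! ## §3 THE FAMILY IN W41's FORMAT: two terms, one polymer label each, placed at the domains `0` (term `false`) and `1` (term `true`);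
the content `v_B := ½ • tab 1`; the activity along the bi-pencil `0 + μ • tab 0 + s • v_B` -/

/-- The placement of each term's ONE polymer label (toy DATA): domain `1` for `true`, domain `0` for `false`. [folklore] -/
abbrev domB : ∀ (_ : ℕ) (b : Bool), Unit → ℕ := fun _ b =>
  match b with
  | true => fun _ => 1
  | false => fun _ => 0

variable (r : ℝ) (hr : 0 ≤ r)

/-- **THE TWO-DOMAIN CORE FAMILY** (toy DATA): term `false` = the core at domain `0`, term `true` = the core at domain `1`, both at W35's weight
`cM r∕2` and contour radius `r` — one `BiCore toyFrame (domB k b) ℂ Unit E1` per term. [folklore] -/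
def GB : ∀ (k : ℕ) (b : Bool), ℕ → BiCore toyFrame (domB k b) ℂ Unit E1 := fun _ b _ =>
  match b with
  | true => coreAt 1 (cM r / 2) r hr
  | false => coreAt 0 (cM r / 2) r hr

/-- The term `true` reads domain `1`. [folklore] -/
@[simp] theorem GB_true (k X : ℕ) : GB r hr k true X = coreAt 1 (cM r / 2) r hr := rfl
/-- The term `false` reads domain `0`. [folklore] -/
@[simp] theorem GB_false (k X : ℕ) : GB r hr k false X = coreAt 0 (cM r / 2) r hr := rfl

/-- THE CONTENT (toy DATA): half the single-domain table at domain `1` (so that `‖v_B‖ ≤ ½ < ε = 1`). [folklore] -/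
def vB : B13HistM toyFrame := (1 / 2 : ℂ) • tab 1

/-- `‖v_B‖ ≤ ½`. [arith] -/
theorem norm_vB_le : ‖vB‖ ≤ 1 / 2 := by
  unfold vB; rw [norm_smul]
  have h : ‖(1 / 2 : ℂ)‖ = 1 / 2 := by rw [norm_div, norm_one, Complex.norm_two]
  rw [h]; linarith [norm_tab_le 1, norm_nonneg (tab 1)]

/-- **THE TABLE AT DOMAIN `1` IS NOT ZERO** (`0 < r`): the core at `1` reads `r·e⁰ = r` off it at the field value `0`. [folklore] -/
theorem tab_one_ne_zero (hr0 : 0 < r) : tab 1 ≠ 0 := by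
  intro h
  have h1 := readOut_coreAt_tab_self 1 (cM r / 2) r hr0.le () (0 : E1)
  rw [h, map_zero] at h1
  have h2 : ((r : ℂ) * (Real.exp (-(crd (0 : E1) ^ 2)) : ℂ)) = 0 := h1.symm
  rcases mul_eq_zero.1 h2 with h3 | h3
  · exact hr0.ne' (by exact_mod_cast h3)
  · exact (Real.exp_pos _).ne' (by exact_mod_cast h3)

/-- `0 < ‖v_B‖` (`0 < r`). [folklore] -/
theorem norm_vB_pos (hr0 : 0 < r) : 0 < ‖vB‖ := by
  unfold vB; rw [norm_smul]
  exact mul_pos (by rw [norm_div, norm_one, Complex.norm_two]; norm_num) (norm_pos_iff.2 (tab_one_ne_zero r hr0))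

section Torus
variable (N : ℕ) [NeZero N]

/-- THE ACTIVITY OF RECORD ALONG THE BI-PENCIL (toy DATA): the two terms summed over W41's index `termsD` at the table
`0 + z.1 • tab 0 + z.2 • v_B` — BY DEFINITION, so S56 §3's `hact` holds by `rfl` (and `hscale` by `rfl`, `emb Z := k`). [folklore] -/
def actB (k : ℕ) (z : ℂ × ℂ) (Z : TDom 4 N) : ℂ :=
  ∑ b ∈ termsD N Z, (GB r hr k b k).termAt (0 : ℂ) ((0 : B13HistM toyFrame) + z.1 • tab 0 + z.2 • vB)

/-! ## §4 (B3) AS A LETTER BUDGET at the table radius `‖0‖ + 1·‖tab 0‖ + 1 ≤ 2`: W41's `budget_half` ONCE PER TERM -/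

/-- **`hM3` ALONG THE BI-PENCIL** [decided toy], in the LITERAL binder shape of S56 §3 at `(h₀, u, μ₁, ε) := (0, tab 0, 1, 1)`: at `X₀` the two
terms' letter masses times read-out growths are `|cM r∕2|·√(2π)·e^{r·(‖tab 0‖ + 1)} ≤ A∕2` each (W41's `budget_half`, `‖tab 0‖ + 1 ≤ 2`), decay
factor `1` (`d(X₀) = 0`, W41's `dj_X₀`); vacuous elsewhere (no term). [folklore] -/
theorem hM3_B (k : ℕ) (R : ℝ) :
    ∀ Z : (tsys 4 N).Dom, (tgeometry 4 N).cubes Z ⊆ (tgeometry 4 N).cubes (X₀ N) →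
      ∑ i ∈ termsD N Z, (GB r hr k i k).lam.real univ *
          ((GB r hr k i k).wB * (fun (_ : ℕ) (_ : Bool) (_ : ℕ) => (1 : ℝ)) k i k *
            Real.exp ((fun (_ : ℕ) (_ : Bool) (_ : ℕ) => (0 : ℝ)) k i k)) *
          (Real.pi / ((fun (_ : ℕ) (_ : Bool) (_ : ℕ) => (1 : ℝ)) k i k / 2)) ^ (Module.finrank ℝ E1 / 2 : ℝ) *
        Real.exp ((GB r hr k i k).N₁ * (‖(0 : B13HistM toyFrame)‖ + 1 * ‖tab 0‖ + 1)) ≤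
      Acst * Real.exp (-(R * (tsys 4 N).dj Z)) := by
  intro Z hZ
  have hZX : Z = X₀ N := (eq_X₀_iff N Z).1 ((Finset.Nonempty.subset_singleton_iff Z.2.1).1 hZ)
  subst hZX
  rw [termsD_X₀, Fintype.sum_bool]
  simp only [GB_true, GB_false]
  rw [letterMass_coreAt, letterMass_coreAt, N₁_coreAt, N₁_coreAt, norm_zero, zero_add, dj_X₀, mul_zero, neg_zero, Real.exp_zero,
    mul_one]
  have hT : 1 * ‖tab 0‖ + 1 ≤ 2 := by linarith [norm_tab_le 0]
  linarith [budget_half r hr hT]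

/-! ## §5 THE END FIRES: S56 §3's window END applied ONCE BY NAME -/

open Classical in
/-- **S56 §3's `rebornMuPart_locE_le_of_coresAt_bipencil_mass_window` FIRES ON THE SEPARABLE TWO-DOMAIN DATUM** [decided toy]:
`(D, G) := (tsys 4 N, tgeometry 4 N)`, `𝔊 := GB` (one polymer label per term at its own domain), W33's `ctr0`∕`hroom0`, NE5's toy letters
`(mq, bq, N₀) = (1, 0, 1)` discharged INLINE per term, `(h₀, u, v, μ₁, ε) := (0, tab 0, v_B, 1, 1)` — `hH` at W33's history radius `2`
(`‖tab 0‖ ≤ 1`), `0 < ‖v_B‖ ≤ ½ < 1` —, `hscale`∕`hact` by `rfl`, `(A, R, r₁, b₅) := (A_cst, 2κ₀ + 2, 0, 0)` with W24's `hrate_torus` and W35's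
`hsmall_mu`, §4's `hM3_B`; for every source window `μ₀ < 1` and `‖μ‖ ≤ μ₀`.  Conclusion LITERAL: the mixed difference of the dressed
one-cube output over `{0, μ} × {0, 1}` is `≤ 4·(e·ν·c₁·K₀²·A·e^{−0·d(X₀)})·μ₀∕(1·1)·‖v_B‖`. [folklore] -/
theorem rebornEnd_fires (hr0 : 0 < r) (k : ℕ) {μ₀ : ℝ} (h01 : μ₀ < 1) {μ : ℂ} (hμ : ‖μ‖ ≤ μ₀) :
    ‖locE (tgeometry 4 N).ι (tgeometry 4 N).cubes (actB r hr N k (μ, 1)) ((tgeometry 4 N).cubes (X₀ N)) -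
          locE (tgeometry 4 N).ι (tgeometry 4 N).cubes (actB r hr N k (0, 1)) ((tgeometry 4 N).cubes (X₀ N)) -
        (locE (tgeometry 4 N).ι (tgeometry 4 N).cubes (actB r hr N k (μ, 0)) ((tgeometry 4 N).cubes (X₀ N)) -
          locE (tgeometry 4 N).ι (tgeometry 4 N).cubes (actB r hr N k (0, 0)) ((tgeometry 4 N).cubes (X₀ N)))‖ ≤
      4 * (Real.exp 1 * (tgeometry 4 N).ν * (tgeometry 4 N).c₁ * (tgeometry 4 N).K₀ ^ 2 * Acst *
          Real.exp (-(0 * (tsys 4 N).dj (X₀ N)))) * μ₀ / (1 * 1) * ‖vB‖ :=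
  rebornMuPart_locE_le_of_coresAt_bipencil_mass_window (tsys 4 N) (tgeometry 4 N) (GB r hr)
    (W := Set.univ) (ctr := ctr0) (ROp := fun _ => 1) (RHist := fun _ => 2) (R' := fun _ => 2)
    (mq := fun _ _ _ => 1) (bq := fun _ _ _ => 0) (N₀ := fun _ _ _ => 1)
    hroom0 (fun _ _ _ _ _ _ _ => one_pos)
    (fun _ _ _ _ _ _ i => by
      cases i <;> exact ⟨fun _ _ => aestronglyMeasurable_const, fun _ => differentiableOn_const _, fun _ _ _ => by
        show ‖(1 : ℂ)‖ ≤ 1; rw [norm_one]⟩)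
    (fun _ _ _ _ _ _ i => by
      cases i <;> exact ⟨fun _ _ => (Complex.measurable_ofReal.comp (measurable_snd.norm.pow_const 2)).aestronglyMeasurable,
        fun _ _ => differentiableOn_const _, fun _ _ _ v => by
          show 1 * ‖v‖ ^ 2 - 0 ≤ (((‖v‖ ^ 2 : ℝ) : ℂ)).re; rw [Complex.ofReal_re]; simp⟩)
    (g := fun _ => 0) (Set.mem_univ _) (U := ()) (o := 0) (h₀ := 0) (u := tab 0) (v := vB) (μ₁ := 1) (μ₀ := μ₀) (ε := 1)
    h01 (norm_vB_pos r hr0) (by linarith [norm_vB_le])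
    (by show ‖(0 : ℂ) - 0‖ ≤ 1; simp)
    (by show ‖(0 : B13HistM toyFrame) - 0‖ + 1 * ‖tab 0‖ + 1 ≤ 2; rw [sub_zero, norm_zero, zero_add]; linarith [norm_tab_le 0])
    (emb := fun _ => k) (fun _ => rfl) (terms := termsD N) (act := actB r hr N k) (fun _ _ _ => rfl)
    (A := Acst) (R := 2 * (tgeometry 4 N).κ₀ + 2) (r₁ := 0) (b₅ := 0) (X₀ := X₀ N)
    Acst_pos.le le_rfl (by norm_num) (hrate_torus N) (hsmall_mu N) (hM3_B r hr N k _) hμ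

open Classical in
/-- **… IN CLOSED FORM: `≤ 4·K₀(64,8)·μ₀·‖v_B‖`** (`e·9·64·K₀(64,8)²·A_cst = K₀(64,8)` by pv22's `torus_consts`∕`K₀_four`, decay `e⁰ = 1`, the
bidisc's `μ₁·ε = 1`): the DRESSED regeneration constant of the toy's re-born μ-part is `4·K₀(64,8)·μ₀`, times the content's size. [folklore] -/
theorem rebornEnd_fires_closed (hr0 : 0 < r) (k : ℕ) {μ₀ : ℝ} (h01 : μ₀ < 1) {μ : ℂ} (hμ : ‖μ‖ ≤ μ₀) :
    ‖locE (tgeometry 4 N).ι (tgeometry 4 N).cubes (actB r hr N k (μ, 1)) ((tgeometry 4 N).cubes (X₀ N)) -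
          locE (tgeometry 4 N).ι (tgeometry 4 N).cubes (actB r hr N k (0, 1)) ((tgeometry 4 N).cubes (X₀ N)) -
        (locE (tgeometry 4 N).ι (tgeometry 4 N).cubes (actB r hr N k (μ, 0)) ((tgeometry 4 N).cubes (X₀ N)) -
          locE (tgeometry 4 N).ι (tgeometry 4 N).cubes (actB r hr N k (0, 0)) ((tgeometry 4 N).cubes (X₀ N)))‖ ≤
      4 * K₀ 64 8 * μ₀ * ‖vB‖ := by
  refine (rebornEnd_fires r hr N hr0 k h01 hμ).trans (le_of_eq ?_)
  rw [(torus_consts N).1, (torus_consts N).2.2, K₀_four, zero_mul, neg_zero, Real.exp_zero, mul_one]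
  unfold Acst
  have hK := K₀_pos (64 : ℝ) 8
  have he := Real.exp_pos 1
  field_simp

open Classical in
/-- **… AND WITH THE CONTENT's SIZE SPENT** (`‖v_B‖ ≤ ½`): `≤ 2·K₀(64,8)·μ₀` for `0 ≤ μ₀ < 1`. [folklore] -/
theorem rebornEnd_fires_unit_content (hr0 : 0 < r) (k : ℕ) {μ₀ : ℝ} (h0 : 0 ≤ μ₀) (h01 : μ₀ < 1) {μ : ℂ} (hμ : ‖μ‖ ≤ μ₀) :
    ‖locE (tgeometry 4 N).ι (tgeometry 4 N).cubes (actB r hr N k (μ, 1)) ((tgeometry 4 N).cubes (X₀ N)) -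
          locE (tgeometry 4 N).ι (tgeometry 4 N).cubes (actB r hr N k (0, 1)) ((tgeometry 4 N).cubes (X₀ N)) -
        (locE (tgeometry 4 N).ι (tgeometry 4 N).cubes (actB r hr N k (μ, 0)) ((tgeometry 4 N).cubes (X₀ N)) -
          locE (tgeometry 4 N).ι (tgeometry 4 N).cubes (actB r hr N k (0, 0)) ((tgeometry 4 N).cubes (X₀ N)))‖ ≤
      2 * K₀ 64 8 * μ₀ := by
  refine (rebornEnd_fires_closed r hr N hr0 k h01 hμ).trans ?_
  have hK := K₀_pos (64 : ℝ) 8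
  have h := mul_le_mul_of_nonneg_left norm_vB_le (by positivity : (0 : ℝ) ≤ 4 * K₀ 64 8 * μ₀)
  linarith

end Torus

end Summit.QuantumFields.BalabanUV.T4Continuum.NE1p.DressedRebornMuPartSeparableWitness

end
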